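import Literature.Geometry.Lorentzian.NonRotatingBlackHoleUniqueness
import HarnessLib

/-!
# No multiple black holes in static vacuum: the future event horizon of a static,
# `I⁺`-regular, vacuum black hole is connected
# (Bunting–Masood-ul-Alam 1987; Chruściel–Reall–Tod 2006; Chruściel–Costa 2008, Thm. 1.4;
# Chruściel–Galloway 2010; Chruściel–Costa–Heusler 2012, Thm. 3.1)

Topic `Literature/Geometry/Lorentzian`; companion of `NonRotatingBlackHoleUniqueness.lean`
(`SudarskyWald1993_staticity`, `ChruscielGalloway2010_docStaticUniqueness`), in exactly its
vocabulary (`StationaryAFBlackHole`, `IsIPlusRegular`, `IsHypersurfaceOrthogonalOn … 𝓑.doc`,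
`IsRicciFlat`, `𝓑.horizon = 𝓔⁺`). Requested by cite item wi-37830 for route `HorizonTypeCascade`
(support `StaticMultiHorizonConnected`, leaf 3a of its cascade): the CONNECTEDNESS of the future
event horizon of a static vacuum black hole — "non-existence of multiple black holes". One named
fact (D-0014), plus its composition with the Sudarsky–Wald staticity fact, proved.

## What is printed (quoted from the held texts)

* G. L. Bunting, A. K. M. Masood-ul-Alam, *Nonexistence of multiple black holes in asymptotically
  Euclidean static vacuum space-time*, Gen. Relativ. Gravit. 19 (1987) 147–154
  [BuntingMasoodUlAlam1987]: an asymptotically Euclidean static vacuum space-time with regular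
  (non-degenerate) horizon components is Schwarzschild; in particular there is only one black
  hole. Method: the conformal rescalings `γ± = ((1 ± V)/2)⁴ γ` of the static slice glued along
  `{V = 0}` give a complete scalar-flat asymptotically flat manifold of vanishing mass, flat by the
  rigidity case of the positive energy theorem (the rescalings are in the tree:
  `scalarCurvature_bmaConformal_eq_zero_of_docStatic`, `DocStaticUniquenessProofs.lean`).
* P. T. Chruściel, J. L. Costa, *On uniqueness of stationary vacuum black holes*, Astérisque 321
  (2008) = arXiv:0806.0016 [ChruscielCosta2008], §1 (held text p. 4): "Assuming staticity, i.e.,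
  stationarity and hypersurface-orthogonality of the stationary Killing vector, a more
  satisfactory result is available in space dimensions less than or equal to seven …:
  non-connected configurations are excluded, without any a priori restrictions on the gradient
  `∇(g(X, X))` at event horizons. … We have the following result, which finds its roots in the
  work of Israel, with further simplifications by Robinson, and with a significant strengthening
  by Bunting and Masood-ul-Alam: **Theorem 1.4.** Under the hypotheses of Conj. 1.2 [a
  stationary, vacuum, four-dimensional space-time containing a spacelike, connected, acausal
  hypersurface `S` such that `S̄` is a topological manifold with boundary, consisting of the union
  of a compact set and of a finite number of asymptotically flat ends; a complete stationary
  Killing vector; `⟨⟨M_ext⟩⟩` globally hyperbolic; `∂S̄ ⊂ M ∖ ⟨⟨M_ext⟩⟩`], suppose moreover that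
  `(⟨⟨M_ext⟩⟩, g)` is analytic and `X` is hypersurface-orthogonal. Let `Ŝ` denote the manifold
  obtained by doubling `S` across the non-degenerate components of its boundary and
  compactifying, in the doubled manifold, all asymptotically flat regions but one to a point. If
  `Ŝ` is of positive energy type, then `⟨⟨M_ext⟩⟩` is isometric to the domain of outer
  communications of a Schwarzschild space-time. **Remark 1.5.** As a corollary of Theorem 1.4 one
  obtains non-existence of black holes as above with some components of the horizon degenerate.
  In space-time dimension four an elementary proof of this fact has been given in [CRT]"
  (Chruściel–Reall–Tod 2006 [ChruscielReallTod2006]); positive energy type "has been proved so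
  far for all `n`-dimensional manifolds obtained by removing a finite number of points from a
  compact manifold of dimension `3 ≤ n ≤ 7`" (ibid.), so the proviso is void in space dimension 3;
  the theorem is APPLIED in §7.2 to a space-time of which exactly the d.o.c. is static.
* P. T. Chruściel, G. J. Galloway, *Uniqueness of static black holes without analyticity*, Class.
  Quantum Grav. 27 (2010) 152001 [ChruscielGalloway2010], Thm. 1.1 (no prehorizons in `I⁺`-regular
  d.o.c.s; "analyticity … can be removed from the set of hypotheses of the classification
  theorems in the static case"), classification restated as Thm. 4.1.
* P. T. Chruściel, J. L. Costa, M. Heusler, *Stationary black holes: uniqueness and beyond*, Living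
  Rev. Relativ. 15 (2012) 7 = arXiv:1205.6112 [ChruscielCostaHeusler2012], §3.1 (held text
  pp. 9–10): "A breakthrough was made by Bunting and Masood-ul-Alam [BMuA87], who showed how to
  use the positive energy theorem to exclude non-connected configurations … The annoying
  hypothesis of analyticity … has been removed in [ChGstatic] … In the static vacuum case the
  remainder of the argument can be simplified by noting that there are no static solutions with
  degenerate horizons, which have spherical cross-sections [CRT]. … **Theorem 3.1.** Let `(M, g)`
  be an electrovacuum, four-dimensional spacetime containing a spacelike, connected, acausal
  hypersurface `S`, such that `S̄` is a topological manifold with boundary consisting of the union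
  of a compact set and of a finite number of asymptotically-flat ends. Suppose that there exists
  on `M` a complete hypersurface-orthogonal Killing vector, that the domain of outer communication
  `⟨⟨M_ext⟩⟩` is globally hyperbolic, and that `∂S̄ ⊂ M ∖ ⟨⟨M_ext⟩⟩`. Then `⟨⟨M_ext⟩⟩` is
  isometric to the domain of outer communications of a Reissner–Nordström or a MP spacetime."

## Rendering and faithfulness

* Hypotheses: VERBATIM those of `ChruscielGalloway2010_docStaticUniqueness` (the same printed
  theorem; see the clause-by-clause comparison in its docstring): `𝓑 : StationaryAFBlackHole`
  (four-dimensional, stationary, one asymptotically flat end), `I⁺`-regular (Chruściel–Costa 2008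
  Def. 1.1, which implies every global hypothesis of Conj. 1.2 / Theorem 3.1), the stationary
  Killing field hypersurface-orthogonal ON `⟨⟨M_ext⟩⟩` (the applied form of §7.2 of
  Chruściel–Costa 2008 and §3.3.1 of CCH12), vacuum (`Ric(g) = 0`: electrovacuum with `F = 0`,
  smooth, NOT analytic — Chruściel–Galloway 2010), `𝓔⁺ ≠ ∅`; minus the three standing technical
  facts `hF hP hres` and `[Kerr.Facts]`, which that fact needs only to STATE its Schwarzschild
  isometry and which play no role in stating connectedness.
* NO non-degeneracy hypothesis: Bunting–Masood-ul-Alam assume non-degenerate ("regular")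
  horizons; degenerate components are excluded in static vacuum by Chruściel–Reall–Tod 2006
  (Chruściel–Costa 2008, Remark 1.5; CCH12 §3.1 "[CRT]"), so the printed classification
  (Theorem 1.4 / Theorem 3.1) carries none, and neither does this fact. The route's leaf, which
  assumes all components non-degenerate, simply does not use that assumption here.
* Conclusion: `IsConnected 𝓑.horizon`, `𝓑.horizon = 𝓔⁺ = ∂I⁻(M_ext) ∩ I⁺(M_ext)`
  (Chruściel–Costa 2008, (2.5)) — "non-connected configurations are excluded" / "nonexistence of
  multiple black holes": in vacuum the Reissner–Nordström / Majumdar–Papapetrou alternative of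
  Theorem 3.1 with `F = 0` and `𝓔⁺ ≠ ∅` is the Schwarzschild d.o.c. of positive mass, whose future
  event horizon in any `I⁺`-regular space-time with that d.o.c. is swept out by the Killing flow
  from the (connected, spherical) boundary of the `I⁺`-regular hypersurface
  (Chruściel–Costa 2008, §4: `𝓔⁺ = ∪ₜ φₜ(∂S̄)`, smooth), hence connected. Nothing is claimed about
  `𝓔⁻` or the black-hole region, as in print.
* Also proved here: the composition with `SudarskyWald1993_staticity` — an `I⁺`-regular vacuum
  black hole whose stationary Killing field generates a non-degenerate horizon (no zeros on `𝓔⁺`,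
  `∇_T T = κ T` there with one constant `κ ≠ 0`) has connected `𝓔⁺`
  (`BuntingMasoodUlAlam1987_horizonConnected.of_nonRotating`), the form in which CCH12 §3.3.1
  chains the staticity theorem with Theorem 3.1.

## References

* [BuntingMasoodUlAlam1987] Gen. Relativ. Gravit. 19 (1987) 147–154, doi:10.1007/BF00770326
  (Theorem; title statement).
* [ChruscielCosta2008] Astérisque 321 (2008) 195–265 = arXiv:0806.0016, §1 p. 4, Thm. 1.4,
  Remark 1.5, Def. 1.1, (2.5), §4, §7.2.
* [ChruscielReallTod2006] Class. Quantum Grav. 23 (2006) 549–554 (no degenerate components in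
  static vacuum).
* [ChruscielGalloway2010] Class. Quantum Grav. 27 (2010) 152001, Thms. 1.1, 4.1.
* [ChruscielCostaHeusler2012] Living Rev. Relativ. 15 (2012) 7 = arXiv:1205.6112, §3.1, Thm. 3.1,
  §3.3.1.
-/

namespace Literature.Geometry.Lorentzian

open Set Function Literature.Geometry.Lorentzian
open scoped Manifold ContDiff Topology

/-- **No multiple black holes in static vacuum (Bunting–Masood-ul-Alam 1987, in the
analyticity-free, degenerate-components-allowed form of Chruściel–Costa 2008 Thm. 1.4 /
Chruściel–Galloway 2010 / Chruściel–Costa–Heusler 2012 Thm. 3.1).**  Let `𝓑` be a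
four-dimensional stationary asymptotically flat black-hole space-time (`StationaryAFBlackHole`)
which is `I⁺`-regular (`IsIPlusRegular`), vacuum (`Ric(g) = 0`, smooth), whose complete
stationary Killing field `T = 𝓑.killing` is hypersurface-orthogonal on the domain of outer
communications `⟨⟨M_ext⟩⟩` (the d.o.c. is static), with non-empty future event horizon
`𝓔⁺ = 𝓑.horizon`.  Then `𝓔⁺` is CONNECTED: "non-connected configurations are excluded"
(Chruściel–Costa 2008, §1), i.e. there is exactly one black hole (Bunting–Masood-ul-Alam: the
positive energy theorem applied to the glued conformal rescalings `((1 ± V)/2)⁴ γ` of the static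
slice; degenerate components excluded by Chruściel–Reall–Tod 2006, analyticity by
Chruściel–Galloway 2010; the classification theorem concludes that `⟨⟨M_ext⟩⟩` is the
Schwarzschild d.o.c., whose future event horizon `∪ₜ φₜ(∂S̄)` is connected).  Hypotheses verbatim
those of `ChruscielGalloway2010_docStaticUniqueness` (same printed theorem) without its
statement-only technical binders; no non-degeneracy is assumed, as in print (module docstring,
"Rendering").  A named fact (D-0014): users take
`(h : BuntingMasoodUlAlam1987_horizonConnected)`.
[cite: BuntingMasoodUlAlam1987, Theorem (title statement: nonexistence of multiple black holes in AE static vacuum)]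
[cite: ChruscielCosta2008, §1 p. 4 ("non-connected configurations are excluded"), Thm. 1.4, Remark 1.5 (degenerate components, after ChruscielReallTod2006), as applied in §7.2]
[cite: ChruscielGalloway2010, Thm. 1.1 and Thm. 4.1 (analyticity removed)]
[cite: ChruscielCostaHeusler2012, §3.1 and Thm. 3.1] -/
def BuntingMasoodUlAlam1987_horizonConnected : Prop :=
  ∀ (𝓑 : StationaryAFBlackHole.{0}) [𝓑.metric.HasLeviCivita],
    𝓑.IsIPlusRegular →
    𝓑.metric.toPseudoRiemannianMetric.IsHypersurfaceOrthogonalOn 𝓑.killing 𝓑.doc →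
    𝓑.metric.toPseudoRiemannianMetric.IsRicciFlat → 𝓑.horizon.Nonempty →
    IsConnected 𝓑.horizon

/-- **Non-rotating, non-degenerate vacuum black holes have connected horizon** — the composition
printed in Chruściel–Costa–Heusler 2012, §3.3.1 (staticity theorem, then Theorem 3.1): given the
two named facts, an `I⁺`-regular vacuum stationary black hole whose stationary Killing field has
no zeros on `𝓔⁺ ≠ ∅` and satisfies `∇_T T = κ T` there for one constant `κ ≠ 0` (non-rotating
with non-degenerate horizon, the hypotheses of `SudarskyWald1993_staticity`) has connected `𝓔⁺`:
Sudarsky–Wald gives staticity of `⟨⟨M_ext⟩⟩`, and `BuntingMasoodUlAlam1987_horizonConnected`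
applies. [cite: ChruscielCostaHeusler2012, §3.3.1 and Thm. 3.1] -/
theorem BuntingMasoodUlAlam1987_horizonConnected.of_nonRotating
    (h : BuntingMasoodUlAlam1987_horizonConnected) (hSW : SudarskyWald1993_staticity)
    (𝓑 : StationaryAFBlackHole.{0}) [𝓑.metric.HasLeviCivita] (hreg : 𝓑.IsIPlusRegular)
    (hvac : 𝓑.metric.toPseudoRiemannianMetric.IsRicciFlat) (hne : 𝓑.horizon.Nonempty)
    (hT : ∀ p ∈ 𝓑.horizon, 𝓑.killing p ≠ 0)
    (hκ : ∃ κ : ℝ, κ ≠ 0 ∧ ∀ p ∈ 𝓑.horizon,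
      𝓑.metric.leviCivita 𝓑.killing p (𝓑.killing p) = κ • 𝓑.killing p) :
    IsConnected 𝓑.horizon :=
  h 𝓑 hreg (hSW 𝓑 hreg hvac hne hT hκ) hvac hne

end Literature.Geometry.Lorentzian
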